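import Summits.KontsevichZagierPeriods.KontsevichZagierPeriods.Theorems.RootDecompZetaThreeFrontierWordRungTwoP11
import Summits.KontsevichZagierPeriods.KontsevichZagierPeriods.Theorems.RootDecompZetaThreeFrontierWordMatchPreludeP6

/-! # `RootDecompZetaThreeFrontierWordRungTwoP12` — part 12/12 of the mechanical ≤270-line split of `RungTwo.stripped.lean`
(split by the decomp-kz census seat for landing; mathematics unchanged; part 12 continues part 11). -/

noncomputable section

namespace Summit.KontsevichZagierPeriods.RootDecompZetaThreeFrontier.WordLayer
open Set MeasureTheory MvPolynomial
open Literature.NumberTheory.Transcendental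
open Summit.KontsevichZagierPeriods.KontsevichZagierPeriods.Theses.RootDecompZetaThreeFrontier
  (HigherWeightDescent)
open Summit.KontsevichZagierPeriods.KontsevichZagierPeriods.Theses.LinRedNormalForm
  (DihedralNormalForm MzvKernelInKZ HoffmanSpanInKZ HoffmanIndependence)

section Necessity
open Literature.ModelTheory.ExponentialFields (IsSemialgebraic)





/-! (private copy of `measurableSet_simplex` — dedup.landed / split policy; origin part RootDecompZetaThreeFrontierWordRungTwoP4a) -/
/-- `simplex` is measurable. [bookkeeping] -/
private theorem measurableSet_simplex (k : ℕ) : MeasurableSet (KZ.openOrderedSimplex k) :=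
  IsSemialgebraic.measurableSet_holds (KZ.isSemialgebraic_openOrderedSimplex k)

/-- **faces**: an integrable genus-zero integrand on `Δ₂` is a corner form `P'/(t₀^{b₀}(1-t₁)^{c₁})` on `Δ₂` -/
theorem faces_cancel (p : MvPolynomial (Fin 2) ℚ) (b₀ b₁ c₀ c₁ a : ℕ)
    (hint : IntegrableOn (gzf p b₀ b₁ c₀ c₁ a) (KZ.openOrderedSimplex 2)) :
    ∃ p' : MvPolynomial (Fin 2) ℚ, EqOn (gzf p b₀ b₁ c₀ c₁ a)
      (fun t => MvPolynomial.aeval t p' / (t 0 ^ b₀ * (1 - t 1) ^ c₁)) (KZ.openOrderedSimplex 2) := by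
  obtain ⟨p₁, h₁⟩ := face_t1 p b₀ b₁ c₀ c₁ a hint
  have hint₁ := hint.congr_fun h₁ (measurableSet_simplex 2)
  obtain ⟨p₂, h₂⟩ := face_diag p₁ b₀ c₀ c₁ a hint₁
  have hint₂ := hint₁.congr_fun h₂ (measurableSet_simplex 2)
  obtain ⟨p₃, h₃⟩ := face_t0 p₂ b₀ c₀ c₁ hint₂
  refine ⟨p₃, fun t ht => ?_⟩
  rw [h₁ ht, h₂ ht, h₃ ht]
  simp only [gzf, pow_zero, mul_one]

/-- the `GZNormalFormW` hypothesis shape at `k = 2` is `gzf` -/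
theorem gzForm_two (p : MvPolynomial (Fin 2) ℚ) (a : Fin 2 → Fin 2 → ℕ) (b c : Fin 2 → ℕ) (t : Fin 2 → ℝ) :
    MvPolynomial.aeval t p / ((∏ i, t i ^ b i) * (∏ i, (1 - t i) ^ c i) *
      ∏ i, ∏ j, if i < j then (t i - t j) ^ a i j else 1) = gzf p (b 0) (b 1) (c 0) (c 1) (a 0 1) t := by
  have h01 : ((0 : Fin 2) < 1) := by decide
  have h00 : ¬ ((0 : Fin 2) < 0) := by decide
  have h10 : ¬ ((1 : Fin 2) < 0) := by decide
  have h11 : ¬ ((1 : Fin 2) < 1) := by decide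
  rw [gzf]
  congr 1
  simp only [Fin.prod_univ_two, if_pos h01, if_neg h00, if_neg h10, if_neg h11]
  ring

/-- **THE RUNG `K = 2` OF THE WEIGHT–DIMENSION LADDER, DECIDED IN FULL (gen 10).**  Every genus-zero representation of
dimension `k ≤ 2` — an integrable `P(t)/(∏ tᵢ^{bᵢ} ∏ (1-tᵢ)^{cᵢ} ∏_{i<j}(tᵢ-tⱼ)^{aᵢⱼ})` on `Δ_k`, `P ∈ ℚ[t]` — is congruent
modulo `KZ.relations` to a `ℤ`-combination of word representations of weight `≤ k`: `ℚ·[pt] + Σ_ε ℚ·[Δ₁,ω_ε] + Σ ℚ·[Δ₂,ω_{ε₀}ω_{ε₁}]`.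
Rungs `0, 1`: §12.  Rung `2`: the three faces cancel into the numerator (§21e), the corner orders are forced (§21d), and the corner
layer lies in the span by the convergent moves of §15–§20 (two-term `γ`-step §19, partition of unity §20).  Item 32433
(`GZNormalFormWThree` ↔ `GZNormalFormW 3`, by name §17) is the next rung. [Kontsevich–Zagier 2001 §1.2; Brown 2009 (`M_{0,5}`)] -/
theorem gzNormalFormW_two : GZNormalFormW 2 := by
  intro k hk r p a b c hd hi
  rcases Nat.lt_or_ge k 2 with hk2 | hk2
  · exact gzNormalFormW_one k (by omega) r p a b c hd hi
  · obtain rfl : k = 2 := le_antisymm hk hk2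
    have hd2 : r.domain = KZ.openOrderedSimplex 2 := hd
    have hi2 : EqOn r.integrand (gzf p (b 0) (b 1) (c 0) (c 1) (a 0 1)) (KZ.openOrderedSimplex 2) := by
      intro t ht
      rw [hi (by rw [hd2]; exact ht)]
      exact gzForm_two p a b c t
    have hint : IntegrableOn (gzf p (b 0) (b 1) (c 0) (c 1) (a 0 1)) (KZ.openOrderedSimplex 2) :=
      (hd2 ▸ r.integrableOn).congr_fun hi2 (measurableSet_simplex 2)
    obtain ⟨p', hp'⟩ := faces_cancel p (b 0) (b 1) (c 0) (c 1) (a 0 1) hint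
    obtain ⟨h0, h1⟩ := corner_orders p' (b 0) (c 1) (hint.congr_fun hp' (measurableSet_simplex 2))
    exact cornerLayer_two p' (b 0) (c 1) h0 h1 r hd2 fun t ht =>
      (hi2 (by rw [← hd2]; exact ht)).trans (hp' (by rw [← hd2]; exact ht))

end Necessity
/-! ## §22  NECESSITY IN DIMENSION 3 (gen 11): integrability of a genus-zero datum on `Δ₃` FORCES the four FACE factors `t₂^{b₂}`,
`(t₁-t₂)^{a₁₂}`, `(t₀-t₁)^{a₀₁}`, `(1-t₀)^{c₀}` to cancel into the numerator — every genus-zero representation of dimension `3` is a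
REDUCED one, `P'/(t₀^{β₀} t₁^{β₁} (1-t₁)^{γ₁} (1-t₂)^{γ₂} (t₀-t₂)^{α})` (`isReduced_of_isGZ_three` = `gz_ladder.stub_three_wlog`, §22g).
The §21 pattern one dimension up: ONE face lemma (`face_lemma3`: `B` fibred over an open base `A ⊆ ℝ²` by intervals `(0, ℓ(x))` in the
last coordinate; Fubini §14b, pole test §12a on each section, and — the one new ingredient — a non-zero polynomial in two variables is
non-zero on an open part of `A` of POSITIVE VOLUME, §22b, by `MvPolynomial.funext_set` on a box) applied to the face `t₂ = 0` directly and
to the faces `t₁ = t₂`, `t₀ = t₁`, `t₀ = 1` through the three linear INVOLUTIONS of `Δ₃` `τ₁₂(t) = (t₀,t₁,t₁-t₂)`, `τ₀₁(t) = (t₀,t₀-t₂,t₀-t₁)`,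
`σ₃(t) = (1-t₂,1-t₁,1-t₀)` (vertex transpositions of `Δ̄₃`, `|det| = 1`, change of variables `integrableOn_comp_invol3`).  No move of the
calculus is used in this section. -/

section NecessityThree
/-! ### 22a  Polynomial bookkeeping in `n` variables and the last row of a `Fin 3` polynomial -/

/-! ### 22b  A non-zero polynomial is non-zero on a part of positive volume of every non-empty open set -/

/-! ### 22c  THE FACE LEMMA IN DIMENSION 3 -/

/-! ### 22d  Transport of integrability by the linear involutions of `Δ₃` -/

/-! ### 22e  The genus-zero integrand of dimension 3 and the three substitutions on polynomials -/

/-! ### 22f  The four faces of `Δ₃` -/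

end NecessityThree
/-! ## §23  NECESSITY IN DIMENSION 3, continued (gen 11): the two VERTEX orders and the three EDGE orders of a reduced datum.
Integrability of `P/(t₀^{β₀} t₁^{β₁} (1-t₁)^{γ₁} (1-t₂)^{γ₂} (t₀-t₂)^{α})` on `Δ₃` forces, monomial by monomial,
`β₀+β₁+α ≤ |e|+2` (vertex `(0,0,0)`), `β₁ ≤ e₁+e₂+1` (edge `t₁=t₂=0`) for `e ∈ supp P`; the same for the dual datum
`P^σ = P(1-t₂,1-t₁,1-t₀)` with `(γ₂,γ₁)` in place of `(β₀,β₁)` (vertex `(1,1,1)`, edge `t₀=t₁=1`); and `α ≤ e₁+e₂+1` for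
`e ∈ supp P^τ`, `P^τ = P(t₀,t₀-t₂,t₀-t₁)` (the diagonal edge `t₀=t₁=t₂`, carried onto `t₁=t₂=0` by `τ₀₁`).  With all orders `0` these
five conditions are exactly the low-pole layer `IsLayerThree`.  Tool: the polynomial chart `Ψ₃(x₀,x₁,s) = (s, s·x₀, s·x₀·x₁)` of `Δ₃` by
the open CUBE (Jacobian `s²x₀`; the vertex becomes the cube face `s = 0`, the edge `t₁=t₂=0` the face `x₀ = 0`), a lift of monomials
absorbing the Jacobian (§21d pattern), and the face lemma §22c on the cube.  No move of the calculus is used. -/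

section OrdersThree
/-! ### 23a  The open cube, the vertex chart and the coordinate swap -/

/-! ### 23b  Lifts of monomials through the charts -/

/-! ### 23c  The vertex order and the edge order forced by integrability -/

/-! ### 23d  The five orders of a reduced datum -/

end OrdersThree
/-! ## Axiom audit (gen 8 headline theorems): kernel-asserted standard closure — a deviation is an ERROR. -/

/-! ## Axiom audit (gen 9 headline theorems) -/

/-! ## Axiom audit (gen 10 headline theorems): rung `K = 2` in full — a deviation is an ERROR. -/

/-! ## Axiom audit (gen 11 headline theorems): the faces of `Δ₃` — a deviation is an ERROR. -/

/-! ## Axiom audit (gen 11 addendum, §23): the vertex and edge orders on `Δ₃` — a deviation is an ERROR. -/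

end Summit.KontsevichZagierPeriods.RootDecompZetaThreeFrontier.WordLayer
/-! ## Axiom audit — a deviation is an ERROR. -/

/-! ## §21f  `gz_ladder.stub_le_two` BY NAME AND SIGNATURE (gen 10/11)
`simplex`, `IsGZ` come from the landed `…Theorems.RootDecompZetaThreeFrontierGZLadderThreeWlog` (p775955); `words`, `CongInto` are reproduced VERBATIM
from the registered skeleton v3; `stub_le_two` is `WordLayer.gzNormalFormW_two` unfolded (`words k` is literally `wordGensLE k`). -/

set_option linter.dupNamespace false

namespace Summit.KontsevichZagierPeriods.KontsevichZagierPeriods.Cruxes.GZNormalFormWThree.GZLadder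

open Set MeasureTheory Literature.NumberTheory.Transcendental

/-- the word generators of weight `≤ k` (verbatim, skeleton `gz_ladder`) -/
def words (k : ℕ) : Set KZ.FormalRep :=
  {x | ∃ (w : ℕ) (ε : Fin w → Bool) (q : ℚ) (s : KZ.IntegralRep w), w ≤ k ∧
    s.domain = {t | (∀ i, 0 < t i) ∧ (∀ i, t i < 1) ∧ StrictAnti t} ∧
    EqOn s.integrand (fun t => (q : ℝ) * ∏ i, if ε i then 1 / (1 - t i) else 1 / t i) s.domain ∧ x = KZ.of s}

-- `CongInto` (verbatim skeleton def) is imported from `…Theorems.RootDecompZetaThreeFrontierWordMatchPreludeP6` (§28b landing).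

/-- the skeleton's `words` IS the word layer's `wordGensLE` -/
theorem words_eq_wordGensLE (k : ℕ) :
    words k = Summit.KontsevichZagierPeriods.RootDecompZetaThreeFrontier.WordLayer.wordGensLE k := rfl

/-- **`gz_ladder.stub_le_two` (rungs `k ≤ 2` of the weight–dimension ladder), PROVED** — by
`WordLayer.gzNormalFormW_two`. -/
theorem stub_le_two : ∀ k ≤ 2, ∀ r : KZ.IntegralRep k, IsGZ k r → CongInto (words k) (KZ.of r) := by
  rintro k hk r ⟨hd, p, a, b, c, hi⟩
  exact Summit.KontsevichZagierPeriods.RootDecompZetaThreeFrontier.WordLayer.gzNormalFormW_two k hk r p a b c hd hi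

end Summit.KontsevichZagierPeriods.KontsevichZagierPeriods.Cruxes.GZNormalFormWThree.GZLadder

end
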